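import Mathlib
import Literature.MathematicalPhysics.QuantumLattice.EuclideanAction
import Literature.Analysis.OperatorTheory.SemigroupJointSpectralMeasure
import Literature.Analysis.OperatorTheory.KernelEnergyMomentumPair
import HarnessLib

/-!
# Pencil rigidity / shell rigidity — kernel-level OS reconstruction along the time axis (stub `stub_axisLaplace`)

Line `transverse-smearing-planar-threshold` of the crux `PencilRigidity.ShellRigidity`
(stmt-QuantumFields-11685). For a kernel `K : ℝ⁴ → ℝ` that is continuous off the origin, bounded
off every slab `{|x⁰| < ε}`, invariant under the time reflection `θ` and under spatial parity, and
POINTWISE reflection positive across `{x⁰ = 0}` (the matrices `K(θxᵢ − xⱼ)`, `xᵢ⁰ > 0`, are positive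
semidefinite), every `ε > 0` admits a finite positive measure `μ_ε` on momentum space, carried by
`{p⁰ ≥ 0}`, with the Laplace–Fourier representation
`K((ε + t)e₀ + a) = ∫ e^{−t p⁰ + i⟨a,p⟩} dμ_ε(p)` for all `t ≥ 0` and spatial `a`
(Berg–Christensen–Ressel, *Harmonic Analysis on Semigroups* (1984), §4.4; Glimm–Jaffe Thm. 6.1.3;
Osterwalder–Schrader 1973, §4.1).

Proof (`stub_axisLaplace`): the complexified kernel `k(x,y) = K(θx − y)` on the open half-space
`{x⁰ > 0}` is Hermitian (parity) and positive semidefinite (`AxisLaplace.re_sum_kernel_nonneg`), so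
Mathlib's Moore–Aronszajn space `RKHS.OfKernel` provides kernel vectors `δₓ` with dense span and
`⟪δₓ, δᵧ⟫ = K(θx − y)` (`Literature.Analysis.OperatorTheory.KernelVectors`). The time shifts `x ↦ x + te₀` are kernel-symmetric with
bounded continuous entries and the spatial shifts are kernel-preserving (`AxisLaplace.kernel_*`,
elementary `ℝ⁴` geometry), so `KernelVectors.exists_isEnergyMomentumPair` (OS iteration + strong
continuity, `Literature/Analysis/OperatorTheory/KernelEnergyMomentumPair.lean`) gives an energy–momentum pair `(T, U)` with
`T(t)U(a)δₓ = δ_{x+a+te₀}` (`AxisLaplace.exists_pair_of_kernel`); the tree's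
`IsEnergyMomentumPair.exists_measure_inner_transfer_translate_eq_integral` at `ψ = δ_{(ε/2)e₀}` is the
representation, since `⟪ψ, T(t)U(a)ψ⟫ = K(−(ε+t)e₀ − a) = K((ε+t)e₀ + a)` (`K` is even).
-/

noncomputable section

namespace Summit.QuantumFields.YangMills.Cruxes.ShellRigidity.TransverseSmearingPlanarThreshold

namespace AxisLaplace

open Filter ComplexConjugate
open scoped InnerProductSpace Topology
open Literature.MathematicalPhysics.QuantumLattice (timeReflection timeReflection_apply)
open Literature.Analysis.OperatorTheory.KernelVectors

/-! ## Geometry of `ℝ⁴` along the time axis and the kernel entries -/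

/-- `0 e₀ = 0` in `ℝ⁴`. -/
theorem single_zero_zero : (EuclideanSpace.single (0 : Fin 4) (0 : ℝ) : EuclideanSpace ℝ (Fin 4)) = 0 :=
  (PiLp.single_eq_zero_iff 2 _).2 rfl

/-- `(s + t) e₀ = s e₀ + t e₀` in `ℝ⁴`. -/
theorem single_zero_add (s t : ℝ) :
    (EuclideanSpace.single (0 : Fin 4) (s + t) : EuclideanSpace ℝ (Fin 4)) =
      EuclideanSpace.single 0 s + EuclideanSpace.single 0 t :=
  PiLp.single_add 2 0

/-- `(θ x)⁰ = -x⁰` in `ℝ⁴`. -/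
theorem timeReflection_four_apply_zero (x : EuclideanSpace ℝ (Fin 4)) : timeReflection 4 x 0 = -x 0 := by
  simp [timeReflection_apply]

/-- `(θ x)¹ = x¹` in `ℝ⁴`. -/
theorem timeReflection_four_apply_one (x : EuclideanSpace ℝ (Fin 4)) : timeReflection 4 x 1 = x 1 := by
  simp [timeReflection_apply]

/-- `(θ x)² = x²` in `ℝ⁴`. -/
theorem timeReflection_four_apply_two (x : EuclideanSpace ℝ (Fin 4)) : timeReflection 4 x 2 = x 2 := by
  simp [timeReflection_apply]

/-- `(θ x)³ = x³` in `ℝ⁴`. -/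
theorem timeReflection_four_apply_three (x : EuclideanSpace ℝ (Fin 4)) : timeReflection 4 x 3 = x 3 := by
  simp [timeReflection_apply]

/-- Time shifts by `t ∨ 0` preserve the open half-space `{x⁰ > 0}`. -/
theorem timeShift_mem (t : ℝ) :
    ∀ x : EuclideanSpace ℝ (Fin 4), 0 < x 0 →
      0 < (x + EuclideanSpace.single 0 (max t 0) : EuclideanSpace ℝ (Fin 4)) 0 := by
  intro x hx
  rw [PiLp.add_apply, PiLp.single_eq_same]
  exact add_pos_of_pos_of_nonneg hx (le_max_right t 0)

/-- Spatial shifts (by `a − a⁰ e₀`) preserve the open half-space `{x⁰ > 0}`. -/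
theorem spaceShift_mem (a : EuclideanSpace ℝ (Fin 4)) :
    ∀ x : EuclideanSpace ℝ (Fin 4), 0 < x 0 →
      0 < (x + (a - EuclideanSpace.single 0 (a 0)) : EuclideanSpace ℝ (Fin 4)) 0 := by
  intro x hx
  rw [PiLp.add_apply, PiLp.sub_apply, PiLp.single_eq_same, sub_self, add_zero]
  exact hx

/-- `θ(x + s e₀) − y = θx − (y + s e₀)`: the time reflection turns a forward time shift of the
reflected point into a forward time shift of the other point (Osterwalder–Schrader (4.7)). -/
theorem timeReflection_add_single_sub (x y : EuclideanSpace ℝ (Fin 4)) (s : ℝ) :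
    timeReflection 4 (x + EuclideanSpace.single 0 s) - y =
      timeReflection 4 x - (y + EuclideanSpace.single 0 s) := by
  ext i
  simp only [PiLp.sub_apply, PiLp.add_apply, timeReflection_apply, PiLp.single_apply]
  split_ifs <;> ring

/-- `θ` fixes spatial vectors: `θ(x + b) − (y + b) = θx − y` for `b = a − a⁰ e₀`
(Osterwalder–Schrader (4.5)). -/
theorem timeReflection_add_spatial_sub (x y a : EuclideanSpace ℝ (Fin 4)) :
    timeReflection 4 (x + (a - EuclideanSpace.single 0 (a 0))) - (y + (a - EuclideanSpace.single 0 (a 0))) =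
      timeReflection 4 x - y := by
  ext i
  simp only [PiLp.sub_apply, PiLp.add_apply, timeReflection_apply, PiLp.single_apply]
  split_ifs with h
  · subst h; ring
  · ring

/-- The time component of `θx − (y + b)` is `−(x⁰ + y⁰ + b⁰)`. -/
theorem timeReflection_sub_add_apply_zero (x y b : EuclideanSpace ℝ (Fin 4)) :
    (timeReflection 4 x - (y + b)) 0 = -(x 0 + y 0 + b 0) := by
  simp only [PiLp.sub_apply, PiLp.add_apply, timeReflection_apply, if_true]
  ring

/-- **Symmetry of the OS kernel from spatial parity**: `K(θy − x) = K(θx − y)`, because the two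
arguments have the same time component and opposite spatial components. -/
theorem kernel_symm {K : EuclideanSpace ℝ (Fin 4) → ℝ}
    (hP : ∀ x y : EuclideanSpace ℝ (Fin 4), y 0 = x 0 → y 1 = -x 1 → y 2 = -x 2 → y 3 = -x 3 →
      K y = K x)
    (x y : EuclideanSpace ℝ (Fin 4)) :
    K (timeReflection 4 y - x) = K (timeReflection 4 x - y) := by
  apply hP
  · rw [PiLp.sub_apply, PiLp.sub_apply, timeReflection_four_apply_zero, timeReflection_four_apply_zero]
    ring
  · rw [PiLp.sub_apply, PiLp.sub_apply, timeReflection_four_apply_one, timeReflection_four_apply_one]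
    ring
  · rw [PiLp.sub_apply, PiLp.sub_apply, timeReflection_four_apply_two, timeReflection_four_apply_two]
    ring
  · rw [PiLp.sub_apply, PiLp.sub_apply, timeReflection_four_apply_three,
      timeReflection_four_apply_three]
    ring

/-- **The kernel is even**, `K(−v) = K(v)`: time reflection composed with spatial parity is `−1`. -/
theorem kernel_even {K : EuclideanSpace ℝ (Fin 4) → ℝ}
    (hθ : ∀ x y : EuclideanSpace ℝ (Fin 4), y 0 = -x 0 → y 1 = x 1 → y 2 = x 2 → y 3 = x 3 →
      K y = K x)
    (hP : ∀ x y : EuclideanSpace ℝ (Fin 4), y 0 = x 0 → y 1 = -x 1 → y 2 = -x 2 → y 3 = -x 3 →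
      K y = K x)
    (v : EuclideanSpace ℝ (Fin 4)) : K (-v) = K v := by
  have h1 : K (timeReflection 4 (-v)) = K (-v) := by
    apply hθ <;> simp [timeReflection_apply]
  have h2 : K (timeReflection 4 (-v)) = K v := by
    apply hP <;> simp [timeReflection_apply]
  rw [← h1, h2]

/-- **Uniform boundedness of the time-shifted kernel entries**: for `x⁰, y⁰ > 0` the arguments
`θx − y − (t ∨ 0)e₀` stay at time-distance `≥ x⁰ + y⁰` from the hyperplane, where `K` is bounded. -/
theorem kernel_bdd {K : EuclideanSpace ℝ (Fin 4) → ℝ}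
    (hbdd : ∀ ε : ℝ, 0 < ε → ∃ B : ℝ, ∀ x : EuclideanSpace ℝ (Fin 4), ε ≤ |x 0| → |K x| ≤ B)
    (x y : EuclideanSpace ℝ (Fin 4)) (hx : 0 < x 0) (hy : 0 < y 0) :
    ∃ C : ℝ, ∀ t : ℝ,
      ‖((K (timeReflection 4 x - (y + EuclideanSpace.single 0 (max t 0))) : ℝ) : ℂ)‖ ≤ C := by
  obtain ⟨B, hB⟩ := hbdd (x 0 + y 0) (add_pos hx hy)
  refine ⟨B, fun t => ?_⟩
  rw [Complex.norm_real, Real.norm_eq_abs]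
  apply hB
  rw [timeReflection_sub_add_apply_zero, PiLp.single_eq_same, abs_neg, abs_of_nonneg (by positivity)]
  linarith [le_max_right t 0]

/-- `t ↦ (t ∨ 0) e₀` is continuous. -/
theorem continuous_single_max :
    Continuous fun t : ℝ => (EuclideanSpace.single (0 : Fin 4) (max t 0) : EuclideanSpace ℝ (Fin 4)) :=
  (PiLp.continuous_toLp 2 _).comp
    ((continuous_single (A := fun _ : Fin 4 => ℝ) 0).comp (continuous_id.max continuous_const))

/-- `a ↦ a − a⁰ e₀` (the spatial part) is continuous. -/
theorem continuous_spatial :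
    Continuous fun a : EuclideanSpace ℝ (Fin 4) => a - EuclideanSpace.single (0 : Fin 4) (a 0) :=
  continuous_id.sub ((PiLp.continuous_toLp 2 _).comp
    ((continuous_single (A := fun _ : Fin 4 => ℝ) 0).comp (PiLp.continuous_apply 2 _ 0)))

/-- **Continuity of the time-shifted kernel entries** `t ↦ K(θx − y − (t ∨ 0)e₀)` for
`x⁰, y⁰ > 0` (the argument avoids `0`, where `K` may be discontinuous). -/
theorem kernel_continuous_time {K : EuclideanSpace ℝ (Fin 4) → ℝ} (hc : ContinuousOn K {x | x ≠ 0})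
    (x y : EuclideanSpace ℝ (Fin 4)) (hx : 0 < x 0) (hy : 0 < y 0) :
    Continuous fun t : ℝ =>
      (((K (timeReflection 4 x - (y + EuclideanSpace.single 0 (max t 0)))) : ℝ) : ℂ) := by
  refine Complex.continuous_ofReal.comp
    (hc.comp_continuous (continuous_const.sub (continuous_const.add continuous_single_max))
      fun t h0 => ?_)
  have h : (timeReflection 4 x - (y + EuclideanSpace.single 0 (max t 0)) : EuclideanSpace ℝ (Fin 4)) 0 = 0 := by
    rw [h0, PiLp.zero_apply]
  rw [timeReflection_sub_add_apply_zero, PiLp.single_eq_same] at h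
  linarith [le_max_right t 0]

/-- **Continuity of the spatially shifted kernel entries** `a ↦ K(θx − y − (a − a⁰e₀))` for
`x⁰, y⁰ > 0`. -/
theorem kernel_continuous_space {K : EuclideanSpace ℝ (Fin 4) → ℝ} (hc : ContinuousOn K {x | x ≠ 0})
    (x y : EuclideanSpace ℝ (Fin 4)) (hx : 0 < x 0) (hy : 0 < y 0) :
    Continuous fun a : EuclideanSpace ℝ (Fin 4) =>
      (((K (timeReflection 4 x - (y + (a - EuclideanSpace.single 0 (a 0))))) : ℝ) : ℂ) := by
  refine Complex.continuous_ofReal.comp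
    (hc.comp_continuous (continuous_const.sub (continuous_const.add continuous_spatial))
      fun a h0 => ?_)
  have h : (timeReflection 4 x - (y + (a - EuclideanSpace.single 0 (a 0))) : EuclideanSpace ℝ (Fin 4)) 0 = 0 := by
    rw [h0, PiLp.zero_apply]
  rw [timeReflection_sub_add_apply_zero, PiLp.sub_apply, PiLp.single_eq_same] at h
  linarith

/-- **Reflection positivity of the complexified kernel**: for finitely supported complex
coefficients on the open half-space, `0 ≤ Re Σₓᵧ conj cₓ cᵧ K(θx − y)` — the real and imaginary
parts of `c` each contribute a nonnegative real quadratic form (`hax`), and the cross terms are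
purely imaginary. -/
theorem re_sum_kernel_nonneg (K : EuclideanSpace ℝ (Fin 4) → ℝ)
    (hax : ∀ (m : ℕ) (x : Fin m → EuclideanSpace ℝ (Fin 4)) (c : Fin m → ℝ), (∀ i, 0 < x i 0) →
      0 ≤ ∑ i, ∑ j, c i * c j * K (timeReflection 4 (x i) - x j))
    (c : {x : EuclideanSpace ℝ (Fin 4) // 0 < x 0} →₀ ℂ) :
    0 ≤ (∑ x ∈ c.support, ∑ y ∈ c.support,
      conj (c x) * c y * ((K (timeReflection 4 x.1 - y.1) : ℝ) : ℂ)).re := by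
  classical
  set s := c.support
  let e : Fin s.card ≃ s := s.equivFin.symm
  let pts : Fin s.card → EuclideanSpace ℝ (Fin 4) := fun i =>
    ((e i : {x : EuclideanSpace ℝ (Fin 4) // 0 < x 0}) : EuclideanSpace ℝ (Fin 4))
  have hpts : ∀ i, 0 < pts i 0 := fun i => (e i : {x : EuclideanSpace ℝ (Fin 4) // 0 < x 0}).2
  have ha := hax s.card pts (fun i => (c (e i)).re) hpts
  have hb := hax s.card pts (fun i => (c (e i)).im) hpts
  have hsum : ∑ x ∈ s, ∑ y ∈ s, conj (c x) * c y * ((K (timeReflection 4 x.1 - y.1) : ℝ) : ℂ) =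
      ∑ i, ∑ j, conj (c (e i)) * c (e j) * ((K (timeReflection 4 (pts i) - pts j) : ℝ) : ℂ) := by
    rw [← Finset.sum_coe_sort s, ← e.sum_comp]
    refine Fintype.sum_congr _ _ fun i => ?_
    rw [← Finset.sum_coe_sort s, ← e.sum_comp]
  have hterm : ∀ i j, (conj (c (e i)) * c (e j) * ((K (timeReflection 4 (pts i) - pts j) : ℝ) : ℂ)).re =
      (c (e i)).re * (c (e j)).re * K (timeReflection 4 (pts i) - pts j) +
        (c (e i)).im * (c (e j)).im * K (timeReflection 4 (pts i) - pts j) := by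
    intro i j
    simp only [Complex.mul_re, Complex.mul_im, Complex.conj_re, Complex.conj_im, Complex.ofReal_re,
      Complex.ofReal_im, mul_zero, sub_zero]
    ring
  rw [hsum, Complex.re_sum]
  simp only [Complex.re_sum, hterm, Finset.sum_add_distrib]
  exact add_nonneg ha hb

/-- **Energy–momentum pair of a reflection-positive kernel on `ℝ⁴`** (kernel-level OS
reconstruction along the time axis): given kernel vectors `δₓ`, `x⁰ > 0`, with dense span and Gram
matrix `⟪δₓ, δᵧ⟫ = K(θx − y)` for a kernel `K` continuous off `0`, bounded off every slab around the
time-zero hyperplane, the time shifts `δₓ ↦ δ_{x + te₀}` (`t ≥ 0`) and the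
spatial shifts `δₓ ↦ δ_{x + a⃗}` extend to an `IsEnergyMomentumPair (T, U)` with
`T(t) U(a) δₓ = δ_{x + a + te₀}` for spatial `a`. -/
theorem exists_pair_of_kernel (K : EuclideanSpace ℝ (Fin 4) → ℝ) (hc : ContinuousOn K {x | x ≠ 0})
    (hbdd : ∀ ε : ℝ, 0 < ε → ∃ B : ℝ, ∀ x : EuclideanSpace ℝ (Fin 4), ε ≤ |x 0| → |K x| ≤ B)
    {H : Type*} [NormedAddCommGroup H] [InnerProductSpace ℂ H] [CompleteSpace H]
    (δ : {x : EuclideanSpace ℝ (Fin 4) // 0 < x 0} → H)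
    (hδ : DenseRange (Finsupp.linearCombination ℂ δ))
    (hinner : ∀ x y, ⟪δ x, δ y⟫_ℂ = ((K (timeReflection 4 x.1 - y.1) : ℝ) : ℂ)) :
    ∃ (T : ℝ → H →L[ℂ] H) (U : EuclideanSpace ℝ (Fin 4) → H →L[ℂ] H),
      Literature.Analysis.OperatorTheory.IsEnergyMomentumPair T U ∧
      ∀ t, 0 ≤ t → ∀ a : EuclideanSpace ℝ (Fin 4), a 0 = 0 →
        ∀ x y : {x : EuclideanSpace ℝ (Fin 4) // 0 < x 0},
          (y : EuclideanSpace ℝ (Fin 4)) = (x : EuclideanSpace ℝ (Fin 4)) + a + EuclideanSpace.single 0 t →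
            T t (U a (δ x)) = δ y := by
  set σ : ℝ → {x : EuclideanSpace ℝ (Fin 4) // 0 < x 0} → {x : EuclideanSpace ℝ (Fin 4) // 0 < x 0} :=
    fun t => Subtype.map (fun x => x + EuclideanSpace.single 0 (max t 0)) (timeShift_mem t) with hσ
  set ρ : EuclideanSpace ℝ (Fin 4) → {x : EuclideanSpace ℝ (Fin 4) // 0 < x 0} →
      {x : EuclideanSpace ℝ (Fin 4) // 0 < x 0} :=
    fun a => Subtype.map (fun x => x + (a - EuclideanSpace.single 0 (a 0))) (spaceShift_mem a) with hρ
  have hσ1 : ∀ t (x : {x : EuclideanSpace ℝ (Fin 4) // 0 < x 0}),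
      ((σ t x : {x : EuclideanSpace ℝ (Fin 4) // 0 < x 0}) : EuclideanSpace ℝ (Fin 4)) =
        (x : EuclideanSpace ℝ (Fin 4)) + EuclideanSpace.single 0 (max t 0) := fun t x => rfl
  have hρ1 : ∀ a (x : {x : EuclideanSpace ℝ (Fin 4) // 0 < x 0}),
      ((ρ a x : {x : EuclideanSpace ℝ (Fin 4) // 0 < x 0}) : EuclideanSpace ℝ (Fin 4)) =
        (x : EuclideanSpace ℝ (Fin 4)) + (a - EuclideanSpace.single 0 (a 0)) := fun a x => rfl
  have hσ0 : ∀ x, σ 0 x = x := fun x => Subtype.ext (by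
    rw [hσ1, max_self, single_zero_zero, add_zero])
  have hσadd : ∀ s t, 0 ≤ s → 0 ≤ t → ∀ x, σ (s + t) x = σ s (σ t x) := fun s t hs ht x =>
    Subtype.ext (by
      rw [hσ1, hσ1, hσ1, max_eq_left hs, max_eq_left ht, max_eq_left (add_nonneg hs ht),
        single_zero_add]
      abel)
  have hσmax : ∀ t x, σ t x = σ (max t 0) x := fun t x =>
    Subtype.ext (by rw [hσ1, hσ1, max_eq_left (le_max_right t 0)])
  have hσsymm : ∀ t x y, ⟪δ (σ t x), δ y⟫_ℂ = ⟪δ x, δ (σ t y)⟫_ℂ := fun t x y => by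
    rw [hinner, hinner, hσ1, hσ1, timeReflection_add_single_sub]
  have hσbdd : ∀ x y, ∃ C : ℝ, ∀ t, ‖⟪δ x, δ (σ t y)⟫_ℂ‖ ≤ C := fun x y => by
    simp only [hinner, hσ1]
    exact kernel_bdd hbdd x.1 y.1 x.2 y.2
  have hσcont : ∀ x y, Continuous fun t => ⟪δ x, δ (σ t y)⟫_ℂ := fun x y => by
    simp only [hinner, hσ1]
    exact kernel_continuous_time hc x.1 y.1 x.2 y.2
  have hρ0 : ∀ x, ρ 0 x = x := fun x => Subtype.ext (by
    rw [hρ1, PiLp.zero_apply, single_zero_zero, sub_zero, add_zero])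
  have hρadd : ∀ a b x, ρ (a + b) x = ρ a (ρ b x) := fun a b x => Subtype.ext (by
    rw [hρ1, hρ1, hρ1, PiLp.add_apply, single_zero_add]
    abel)
  have hρσ : ∀ a t x, ρ a (σ t x) = σ t (ρ a x) := fun a t x => Subtype.ext (by
    rw [hρ1, hσ1, hσ1, hρ1]
    abel)
  have hρinner : ∀ a x y, ⟪δ (ρ a x), δ (ρ a y)⟫_ℂ = ⟪δ x, δ y⟫_ℂ := fun a x y => by
    rw [hinner, hinner, hρ1, hρ1, timeReflection_add_spatial_sub]
  have hρcont : ∀ x y, Continuous fun a => ⟪δ x, δ (ρ a y)⟫_ℂ := fun x y => by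
    simp only [hinner, hρ1]
    exact kernel_continuous_space hc x.1 y.1 x.2 y.2
  have hρsingle : ∀ s x, ρ (EuclideanSpace.single 0 s) x = x := fun s x => Subtype.ext (by
    rw [hρ1, PiLp.single_eq_same, sub_self, add_zero])
  obtain ⟨T, U, hEM, hT, hU⟩ := exists_isEnergyMomentumPair (d := 4) δ hδ σ ρ hσ0 hσadd hσmax hσsymm
    hσbdd hσcont hρ0 hρadd hρσ hρinner hρcont hρsingle
  refine ⟨T, U, hEM, fun t ht a ha x y hy => ?_⟩
  rw [← lc_single δ x, hU, hT, Finsupp.mapDomain_single, Finsupp.mapDomain_single, lc_single]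
  congr 1
  apply Subtype.ext
  rw [hy, hσ1, hρ1, ha, single_zero_zero, sub_zero, max_eq_left ht]

end AxisLaplace

/-! ## The registered stub -/

open MeasureTheory Complex
open scoped InnerProductSpace ComplexConjugate
open Literature.MathematicalPhysics.QuantumLattice
open Literature.Analysis.OperatorTheory.KernelVectors

/-- **Stub 2 · kernel-level Osterwalder–Schrader reconstruction along the time axis**
(Berg–Christensen–Ressel, *Harmonic Analysis on Semigroups*, §4.4; Glimm–Jaffe Thm. 6.1.3;
Osterwalder–Schrader 1973, §4.1). For a kernel `K` on `ℝ⁴` that is continuous off `0`, bounded off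
every slab `{|x⁰| < ε}`, invariant under time reflection and under spatial parity, and pointwise
reflection positive across `{x⁰ = 0}`, every `ε > 0` admits a finite positive measure `μ_ε` on
`{p⁰ ≥ 0}` with `K((ε + t)e₀ + a) = ∫ e^{−t p⁰ + i⟨a, p⟩} dμ_ε(p)` for `t ≥ 0` and spatial `a`.
Proof: the Moore–Aronszajn space of the positive semidefinite kernel `K(θx − y)` on `{x⁰ > 0}`
(Mathlib's `RKHS.OfKernel`) carries the contraction semigroup of time shifts (OS iteration against
the boundedness of `K`) and the unitary group of spatial shifts, an `IsEnergyMomentumPair`; the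
tree's `IsEnergyMomentumPair.exists_measure_inner_transfer_translate_eq_integral` at the kernel
vector of `(ε/2)e₀` gives `μ_ε`, and `K` is even. -/
theorem stub_axisLaplace (K : EuclideanSpace ℝ (Fin 4) → ℝ)
    (hc : ContinuousOn K {x | x ≠ 0})
    (hbdd : ∀ ε : ℝ, 0 < ε → ∃ B : ℝ, ∀ x : EuclideanSpace ℝ (Fin 4), ε ≤ |x 0| → |K x| ≤ B)
    (hθ : ∀ x y : EuclideanSpace ℝ (Fin 4), y 0 = -x 0 → y 1 = x 1 → y 2 = x 2 → y 3 = x 3 → K y = K x)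
    (hP : ∀ x y : EuclideanSpace ℝ (Fin 4), y 0 = x 0 → y 1 = -x 1 → y 2 = -x 2 → y 3 = -x 3 → K y = K x)
    (hax : ∀ (m : ℕ) (x : Fin m → EuclideanSpace ℝ (Fin 4)) (c : Fin m → ℝ), (∀ i, 0 < x i 0) →
      0 ≤ ∑ i, ∑ j, c i * c j * K (timeReflection 4 (x i) - x j))
    (ε : ℝ) (hε : 0 < ε) :
    ∃ μ : Measure (EuclideanSpace ℝ (Fin 4)), IsFiniteMeasure μ ∧ μ {p | p 0 < 0} = 0 ∧
      ∀ t : ℝ, 0 ≤ t → ∀ a : EuclideanSpace ℝ (Fin 4), a 0 = 0 →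
        ((K (EuclideanSpace.single 0 (ε + t) + a) : ℝ) : ℂ) =
          ∫ p, cexp (((-(t * p 0) : ℝ) : ℂ) + ((⟪a, p⟫_ℝ : ℝ) : ℂ) * I) ∂μ := by
  -- the complexified OS kernel on the open half-space
  set k : {x : EuclideanSpace ℝ (Fin 4) // 0 < x 0} → {x : EuclideanSpace ℝ (Fin 4) // 0 < x 0} → ℂ :=
    fun x y => ((K (timeReflection 4 x.1 - y.1) : ℝ) : ℂ) with hk
  have hk_symm : ∀ x y, conj (k y x) = k x y := fun x y => by
    rw [hk, Complex.conj_ofReal, AxisLaplace.kernel_symm hP]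
  haveI hfact : Fact (Matrix.of fun x y => k x y • (1 : ℂ →L[ℂ] ℂ)).PosSemidef :=
    ⟨posSemidef_smul_one k hk_symm fun c => AxisLaplace.re_sum_kernel_nonneg K hax c⟩
  -- its Moore–Aronszajn space and the energy–momentum pair
  obtain ⟨T, U, hEM, hTU⟩ := AxisLaplace.exists_pair_of_kernel K hc hbdd
    (fun x => RKHS.kerFun (RKHS.OfKernel (Matrix.of fun x y => k x y • (1 : ℂ →L[ℂ] ℂ))) x (1 : ℂ))
    (denseRange_lc_kerFun_one _) (fun x y => by rw [inner_kerFun_one k hk_symm])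
  -- the joint spectral measure at the kernel vector of `(ε/2) e₀`
  have hx₀ : 0 < (EuclideanSpace.single (0 : Fin 4) (ε / 2) : EuclideanSpace ℝ (Fin 4)) 0 := by
    rw [PiLp.single_eq_same]; exact half_pos hε
  obtain ⟨μ, hfin, hsupp, hint⟩ := hEM.exists_measure_inner_transfer_translate_eq_integral
    (RKHS.kerFun (RKHS.OfKernel (Matrix.of fun x y => k x y • (1 : ℂ →L[ℂ] ℂ))) ⟨_, hx₀⟩ (1 : ℂ))
  refine ⟨μ, hfin, hsupp, fun t ht a ha => ?_⟩
  rw [← hint t ht a ha]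
  have hy₀ : 0 < (EuclideanSpace.single (0 : Fin 4) (ε / 2) + a + EuclideanSpace.single 0 t :
      EuclideanSpace ℝ (Fin 4)) 0 := by
    rw [PiLp.add_apply, PiLp.add_apply, PiLp.single_eq_same, PiLp.single_eq_same, ha]
    positivity
  rw [hTU t ht a ha ⟨_, hx₀⟩ ⟨_, hy₀⟩ rfl, inner_kerFun_one k hk_symm]
  simp only [hk]
  rw [← AxisLaplace.kernel_even hθ hP (EuclideanSpace.single 0 (ε + t) + a)]
  congr 2
  ext i
  simp only [PiLp.neg_apply, PiLp.add_apply, PiLp.sub_apply, timeReflection_apply, PiLp.single_apply]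
  split_ifs <;> ring

end Summit.QuantumFields.YangMills.Cruxes.ShellRigidity.TransverseSmearingPlanarThreshold
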